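import Literature.IUT.HodgeArakelov.ThetaEvaluationModelEvDiagramGenuine
import Literature.IUT.HodgeArakelov.AbsTopMonoidsGenuineIsometries
import HarnessLib

/-!
# [IUTchII] Cor 1.12 (iii) at the model: the `Γ^{×μ}`-ORBIT of the `α_×`-induced last arrow of `(†μ,×μ)`, with
# `Γ^{×μ} = Ism(G)` GENUINE (proof-only)

S. Mochizuki, *Inter-universal Teichmüller theory II*, §1, Corollary 1.12 (iii), kurims manuscript (Dec. 2020) p. 58
[claim: Mochizuki2012, status: disputed] (IUTchII §1 Cor 1.12 (iii), kurims p.58): in the diagram `(†μ,×μ)`, "the final `≅`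
denotes the poly-isomorphism induced by the poly-isomorphism `α_×` of Example 1.8, (iii) [cf. also the discussion of `Γ^{×μ}`
in Example 1.8, (iv)]" — i.e. (Ex. 1.8 (v)/(viii) p. 39/41: isomorphisms of coric data `G ↷ O^{×μ}(G)` are
`Γ^{×μ}`-MULTIPLES, `Γ^{×μ} ⊆ Ism(−)`, "one example … `Ism` … another … the image `Im(Ẑ^×)` of `Ẑ^× ↠ ℤ_p^× ↪ Ism`") the
`Γ^{×μ}`-orbit of the identifications `M^{×μ}_TM(Π) ≅ O^{×μ}(G)` induced by the members of the full poly-isomorphism.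
abc-iut cell, layer L6, node **IUTchII:Cor1.12(iii)**, row «COR112iii-ISM-ORBIT» (abc-iut-L6-lead §F v1.19t); seat
abc-iut-L6-d2 (gen 5).  PROOF-ONLY sequel of abc-iut-w4-d043's `ThetaEvaluationModelEvDiagram(Genuine).lean`
(p425654/p427441: the diagram with last arrow `= {π ∘ (Kummer identification)⁻¹ | π ∈ P₀}`, and `P₀ =` the `α_×`-induced
identifications — their honest residual: "the `Ism(G)`-orbit of print is not formed — `Ism` DEGENERATE in the producer")
and of this seat's `AbsTopMonoidsGenuineIsometries.lean` (p427597: `Ism(G)` and `Ẑ^× ↠ ℤ_p^× ↪ Ism(G)` GENUINE).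

* `AbsTopMonoids.alphaTimesIsmOxmu_nonempty` / `alphaTimesZHatOxmu_nonempty` — over ANY [AbsTopIII]-output interface `A`:
  the `Γ^{×μ}`-orbits `{γ ∘ π_f}` of the `α_×`-induced identifications (`Γ^{×μ} = Ism(G)` acting through `A.actIsm`,
  resp. `Γ^{×μ} = Im(Ẑ^×)` through `A.actIsm ∘ A.toIsm`) are non-empty;
* `EtaleLevels.cor112_iii_model_ismOrbit_of_unitsEquiv` / `…_zhatOrbit_of_unitsEquiv` — for the model theta-evaluation
  datum of record and ANY `A`, `Π*`, `G`, `ιU`: the diagram `(†μ,×μ)` EXISTS with last arrow `poly₄₅ =` **the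
  `Γ^{×μ}`-orbit**: `e ∈ poly₄₅` iff for some member `f : Π*/Δ* ⥲ G` of the full poly-isomorphism and some
  `γ ∈ Γ^{×μ}`, `e[κ_D u] = γ · [O^⊳(f)((*TM⊳)(ιU u))]` for every unit constant `u`;
* `EtaleLevels.cor112_iii_model_genuineIsm_of_tower` / `…_genuineZHat_of_tower` — at the FULLY GENUINE producer
  `AbsTopMonoids.genuineOfModelIsm` over `(k, ℚ̄_p)`, `k/ℚ_p` finite: `Γ^{×μ} = Ism(G)` IS print\'s isometry group of
  `G ↷ (𝒪^⊳_{ℚ̄_p})ˣ⧸μ` (`genuineOfModelIsm_Ism`) and `e[κ_D u] = γ · [liftM(φ_f)(u)]`; for `Γ^{×μ} = Im(Ẑ^×)`,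
  `e[κ_D u] = [liftM(φ_f)(u)]^{χ_p(v)}`, `v ∈ Ẑ^×` (`toAdd_log_actIsm_toIsm`).

Residual named inputs: exactly abc-iut-w4-d043's (`hcU`; `[G_{ℚ_p} : ε(D_{μ_-})] < ∞` + `hDq`/`hlift`/`hemb`; the
producer's `ε`/(H1)/(H2)).  HONEST FRAMING: record-only under a disputed claim key; nothing here bears on [IUTchIII] Cor.
3.12; typed ≠ proved elsewhere.
-/

set_option autoImplicit false

noncomputable section

namespace Literature.IUT.HodgeArakelov

open CategoryTheory

universe u

/-! ### The `Γ^{×μ}`-orbits of the `α_×`-induced identifications — generic interface -/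

namespace AbsTopMonoids

variable {S : ThetaSetting.{u}} (A : AbsTopMonoids S) (P : IsoClass S.PiX) (G : IsoClass S.Gk)
  {V : Type u} [CommGroup V] (ιU : V ≃* (A.MTM P)ˣ)

/-- **The `Ism(G)`-orbit of the `α_×`-induced poly-isomorphism on `(−)^{×μ}` is non-empty** (`γ := 1`; the full
poly-isomorphism `Π*/Δ* ≅ G` is non-empty). [claim: Mochizuki2012, status: disputed] (IUTchII §1 Ex 1.8 (v), kurims p.39) -/
theorem alphaTimesIsmOxmu_nonempty :
    {π : V ⧸ CommGroup.torsion V ≃* A.Oxmu G |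
      ∃ (f : (⟨TopGroup.quot P.G (A.Delta P), A.quotIso P⟩ : IsoClass S.Gk) ⟶ G) (γ : A.Ism G), ∀ v : V,
        π (QuotientGroup.mk v) =
          A.actIsm G γ (QuotientGroup.mk (Units.map ((A.tauto P).trans (A.mapOtri f)).toMonoidHom (ιU v)))}.Nonempty := by
  obtain ⟨π, f, hπ⟩ := A.alphaTimesOxmu_nonempty P G ιU
  refine ⟨π, f, 1, fun v => ?_⟩
  rw [map_one, MulAut.one_apply]
  exact hπ v

/-- **The `Im(Ẑ^×)`-orbit of the `α_×`-induced poly-isomorphism on `(−)^{×μ}` is non-empty** (`v := 1`).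
[claim: Mochizuki2012, status: disputed] (IUTchII §1 Ex 1.8 (v), kurims p.39) -/
theorem alphaTimesZHatOxmu_nonempty :
    {π : V ⧸ CommGroup.torsion V ≃* A.Oxmu G |
      ∃ (f : (⟨TopGroup.quot P.G (A.Delta P), A.quotIso P⟩ : IsoClass S.Gk) ⟶ G) (w : ZHatUnits), ∀ v : V,
        π (QuotientGroup.mk v) =
          A.actIsm G (A.toIsm G w) (QuotientGroup.mk (Units.map ((A.tauto P).trans (A.mapOtri f)).toMonoidHom (ιU v)))}.Nonempty := by
  obtain ⟨π, f, hπ⟩ := A.alphaTimesOxmu_nonempty P G ιU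
  refine ⟨π, f, 1, fun v => ?_⟩
  rw [map_one, map_one, MulAut.one_apply]
  exact hπ v

end AbsTopMonoids

/-! ### Assembly at the model -/

open Literature.AnabelianGeometry.EtaleTheta Literature.AnabelianGeometry.SemiGraphs CohomologySystemOfContH1
open Literature.AnabelianGeometry.AbsoluteAnabelian
open scoped Literature.AnabelianGeometry.EtaleTheta

namespace EtaleLevels

variable {p : ℕ} [Fact p.Prime] {D : Literature.AnabelianGeometry.EtaleTheta.ThetaSetting p}
  {E : D.EtaleThetaData} {l : ℕ} (C : E.DoubleUnderline l) (hC : D.Compat) (hS : D.Sec2Hyps)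
  (hl : l.Prime) (hp2 : p ≠ 2) (hpl : p ≠ l) (hζ : ∃ ζ : D.K, IsPrimitiveRoot ζ (4 * l))
  (mods : ∀ M : ℕ+, D.CyclotomeMod l M)
  (f : contCocycles D.toTheta D.DeltaTheta C.GtpYdduu) (hf : f ∈ C.rootCocycles hC)
  (hmods : ∀ (M M' : ℕ+) (h : (M : ℕ) ∣ (M' : ℕ)) (x : D.lDeltaTheta l),
    MuN.red p M M' h ((mods M').red x) = (mods M).red x)
  (h15 : Literature.AnabelianGeometry.EtaleTheta.ThetaSetting.Prop15iii E hC) (L : C.CuspLabels)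
  (hZ : ∀ M : ℕ+, Nonempty (ModelCyclotomes.lDeltaQuot (C.rigidData (mods M) hC hS h15 L) ≃*
    Literature.IUT.HodgeTheaters.ZHat))
  (hcharY : EtaleThetaDataOfSetting.PiYddCharacteristic C)
  (hlim : Function.Bijective (rigidLimHom C hC hS hl hp2 hpl hζ mods f hf hmods h15 L hZ))
  (Env : EnvOfGroup (setting C hC hS hl hp2 hpl hζ mods f hf)
    (modelSystem C hC hS hl hp2 hpl hζ mods f hf hmods h15 L hZ).PiX)
  (I : PointedInversion Env (thetaEnvData C hC hS hl hp2 hpl hζ mods f hf hmods h15 L hZ hcharY hlim).D)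
  (hDq : ∀ d ∈ I.Dmu, EtaleThetaDataOfSetting.aug C d = 1 → d = 1)
  (hlift : ∀ K : Subgroup (EtaleThetaDataOfSetting.Pi C), K.FiniteIndex → IsOpen (K : Set (EtaleThetaDataOfSetting.Pi C)) →
    (liftSubgroup (EtaleThetaDataOfSetting.aug C) I.Dmu K).FiniteIndex ∧
      IsOpen (liftSubgroup (EtaleThetaDataOfSetting.aug C) I.Dmu K : Set (EtaleThetaDataOfSetting.Pi C)))
  (hemb : ∀ K : Subgroup (EtaleThetaDataOfSetting.Pi C),
    Topology.IsEmbedding fun d : ↥(I.Dmu ⊓ K) => EtaleThetaDataOfSetting.aug C d.1)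
  (cU : CyclotomeCoefficients (EtaleThetaDataOfSetting.phi C) (D.lDeltaTheta l) (PadicAlgCl p)ˣ)
  (ρlim : (EtaleThetaDataOfSetting.coh C).lim ≃+ (EtaleThetaDataOfSetting.coh C).lim)

/-- **[IUTchII] Cor 1.12 (iii) at the model, last arrow = the `Ism(G)`-ORBIT of the `α_×`-induced poly-isomorphism.**
For the model datum of record (`EtaleLevels.thetaEvaluation`), ANY [AbsTopIII]-output interface `A` with isomorph `Π*` (`P`),
`G ≅ G_k` and identification `ιU` of the unit constants with `M_TM(Π*)^×`: the diagram `(†μ,×μ)` EXISTS with last arrow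
`poly₄₅` EQUAL TO the `Γ^{×μ}`-orbit, `Γ^{×μ} := Ism(G)`: `e` is a member iff, for some member `f : Π*/Δ* ⥲ G` of the full
poly-isomorphism and some `γ ∈ Ism(G)`, `e` carries the class of `κ_D u` to `γ · [O^⊳(f)((*TM⊳)(ιU u))]` for every unit
constant `u`. [claim: Mochizuki2012, status: disputed] (IUTchII §1 Cor 1.12 (iii), kurims p.58) -/
theorem cor112_iii_model_ismOrbit_of_unitsEquiv [(Subgroup.map (EtaleThetaDataOfSetting.aug C) I.Dmu).FiniteIndex]
    (hcU : Function.Bijective cU.hom)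
    (A : AbsTopMonoids (setting C hC hS hl hp2 hpl hζ mods f hf)) (P : IsoClass (setting C hC hS hl hp2 hpl hζ mods f hf).PiX)
    (G : IsoClass (setting C hC hS hl hp2 hpl hζ mods f hf).Gk)
    (ιU : ↥(unitGroup ℚ_[p] (PadicAlgCl p)) ≃* (A.MTM P)ˣ) :
    ∃ Δ : MuXmuDiagram
        (thetaEvaluation C hC hS hl hp2 hpl hζ mods f hf hmods h15 L hZ hcharY hlim Env I
            (LevelRetraction.ofAugmentation (EtaleThetaDataOfSetting.phi C) (D.lDeltaTheta l)
              (EtaleThetaDataOfSetting.aug C) I.Dmu hDq (EtaleThetaDataOfSetting.PiYdd C)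
              (EtaleThetaDataOfSetting.continuous_aug C) (aug_ker_acts_trivially C) hlift hemb)
            cU (EtaleThetaDataOfSetting.isOpen_stabilizer_units C) (EtaleThetaDataOfSetting.finiteIndex_stabilizer_units C)
            (unitGroup ℚ_[p] (PadicAlgCl p)) ρlim) A G
        ↥(AddCommGroup.torsion (thetaEnvData C hC hS hl hp2 hpl hζ mods f hf hmods h15 L hZ hcharY hlim).cohEnv.lim)
        (AddCommGroup.torsion (thetaEnvData C hC hS hl hp2 hpl hζ mods f hf hmods h15 L hZ hcharY hlim).cohEnv.lim).subtype,
      Δ.poly₄₅ = {e | ∃ (φ : (⟨TopGroup.quot P.G (A.Delta P), A.quotIso P⟩ :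
          IsoClass (setting C hC hS hl hp2 hpl hζ mods f hf).Gk) ⟶ G) (γ : A.Ism G),
        ∀ (u : ↥(unitGroup ℚ_[p] (PadicAlgCl p)))
          (m : ↥(thetaEvaluation C hC hS hl hp2 hpl hζ mods f hf hmods h15 L hZ hcharY hlim Env I
            (LevelRetraction.ofAugmentation (EtaleThetaDataOfSetting.phi C) (D.lDeltaTheta l)
              (EtaleThetaDataOfSetting.aug C) I.Dmu hDq (EtaleThetaDataOfSetting.PiYdd C)
              (EtaleThetaDataOfSetting.continuous_aug C) (aug_ker_acts_trivially C) hlift hemb)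
            cU (EtaleThetaDataOfSetting.isOpen_stabilizer_units C) (EtaleThetaDataOfSetting.finiteIndex_stabilizer_units C)
            (unitGroup ℚ_[p] (PadicAlgCl p)) ρlim).MxTM),
          (m : (thetaEvaluation C hC hS hl hp2 hpl hζ mods f hf hmods h15 L hZ hcharY hlim Env I
            (LevelRetraction.ofAugmentation (EtaleThetaDataOfSetting.phi C) (D.lDeltaTheta l)
              (EtaleThetaDataOfSetting.aug C) I.Dmu hDq (EtaleThetaDataOfSetting.PiYdd C)
              (EtaleThetaDataOfSetting.continuous_aug C) (aug_ker_acts_trivially C) hlift hemb)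
            cU (EtaleThetaDataOfSetting.isOpen_stabilizer_units C) (EtaleThetaDataOfSetting.finiteIndex_stabilizer_units C)
            (unitGroup ℚ_[p] (PadicAlgCl p)) ρlim).Hd) =
              Multiplicative.toAdd (h1LimKummer (EtaleThetaDataOfSetting.phi C) (D.lDeltaTheta l) I.Dmu cU
                (EtaleThetaDataOfSetting.isOpen_stabilizer_units C) (EtaleThetaDataOfSetting.finiteIndex_stabilizer_units C) u) →
            e (Multiplicative.ofAdd (QuotientAddGroup.mk m)) =
              A.actIsm G γ (QuotientGroup.mk (Units.map ((A.tauto P).trans (A.mapOtri φ)).toMonoidHom (ιU u)))} := by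
  obtain ⟨Δ, hΔ⟩ := cor112_iii_model C hC hS hl hp2 hpl hζ mods f hf hmods h15 L hZ hcharY hlim Env I hDq hlift hemb cU ρlim
    hcU A G _ (A.alphaTimesIsmOxmu_nonempty P G ιU)
  refine ⟨Δ, ?_⟩
  rw [hΔ]
  ext e
  simp only [Set.mem_setOf_eq]
  constructor
  · rintro ⟨π, ⟨φ, γ, hπ⟩, he⟩
    exact ⟨φ, γ, fun u m hm => (he u m hm).trans (hπ u)⟩
  · rintro ⟨φ, γ, he⟩
    obtain ⟨π, hπ⟩ := A.exists_oxmuEquiv_alphaTimes P G ιU φ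
    refine ⟨π.trans (A.actIsm G γ), ⟨φ, γ, fun v => ?_⟩, fun u m hm => ?_⟩
    · rw [MulEquiv.trans_apply, hπ]
    · rw [he u m hm, MulEquiv.trans_apply, hπ]

/-- **… last arrow = the `Im(Ẑ^×)`-ORBIT** (`Γ^{×μ} :=` the image of `Ẑ^× ↠ ℤ_p^× ↪ Ism(G)`, acting through
`A.actIsm ∘ A.toIsm`): `e ∈ poly₄₅` iff for some `f` and some `w ∈ Ẑ^×`, `e[κ_D u] = w · [O^⊳(f)((*TM⊳)(ιU u))]`.
[claim: Mochizuki2012, status: disputed] (IUTchII §1 Cor 1.12 (iii), kurims p.58) -/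
theorem cor112_iii_model_zhatOrbit_of_unitsEquiv [(Subgroup.map (EtaleThetaDataOfSetting.aug C) I.Dmu).FiniteIndex]
    (hcU : Function.Bijective cU.hom)
    (A : AbsTopMonoids (setting C hC hS hl hp2 hpl hζ mods f hf)) (P : IsoClass (setting C hC hS hl hp2 hpl hζ mods f hf).PiX)
    (G : IsoClass (setting C hC hS hl hp2 hpl hζ mods f hf).Gk)
    (ιU : ↥(unitGroup ℚ_[p] (PadicAlgCl p)) ≃* (A.MTM P)ˣ) :
    ∃ Δ : MuXmuDiagram
        (thetaEvaluation C hC hS hl hp2 hpl hζ mods f hf hmods h15 L hZ hcharY hlim Env I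
            (LevelRetraction.ofAugmentation (EtaleThetaDataOfSetting.phi C) (D.lDeltaTheta l)
              (EtaleThetaDataOfSetting.aug C) I.Dmu hDq (EtaleThetaDataOfSetting.PiYdd C)
              (EtaleThetaDataOfSetting.continuous_aug C) (aug_ker_acts_trivially C) hlift hemb)
            cU (EtaleThetaDataOfSetting.isOpen_stabilizer_units C) (EtaleThetaDataOfSetting.finiteIndex_stabilizer_units C)
            (unitGroup ℚ_[p] (PadicAlgCl p)) ρlim) A G
        ↥(AddCommGroup.torsion (thetaEnvData C hC hS hl hp2 hpl hζ mods f hf hmods h15 L hZ hcharY hlim).cohEnv.lim)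
        (AddCommGroup.torsion (thetaEnvData C hC hS hl hp2 hpl hζ mods f hf hmods h15 L hZ hcharY hlim).cohEnv.lim).subtype,
      Δ.poly₄₅ = {e | ∃ (φ : (⟨TopGroup.quot P.G (A.Delta P), A.quotIso P⟩ :
          IsoClass (setting C hC hS hl hp2 hpl hζ mods f hf).Gk) ⟶ G) (w : ZHatUnits),
        ∀ (u : ↥(unitGroup ℚ_[p] (PadicAlgCl p)))
          (m : ↥(thetaEvaluation C hC hS hl hp2 hpl hζ mods f hf hmods h15 L hZ hcharY hlim Env I
            (LevelRetraction.ofAugmentation (EtaleThetaDataOfSetting.phi C) (D.lDeltaTheta l)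
              (EtaleThetaDataOfSetting.aug C) I.Dmu hDq (EtaleThetaDataOfSetting.PiYdd C)
              (EtaleThetaDataOfSetting.continuous_aug C) (aug_ker_acts_trivially C) hlift hemb)
            cU (EtaleThetaDataOfSetting.isOpen_stabilizer_units C) (EtaleThetaDataOfSetting.finiteIndex_stabilizer_units C)
            (unitGroup ℚ_[p] (PadicAlgCl p)) ρlim).MxTM),
          (m : (thetaEvaluation C hC hS hl hp2 hpl hζ mods f hf hmods h15 L hZ hcharY hlim Env I
            (LevelRetraction.ofAugmentation (EtaleThetaDataOfSetting.phi C) (D.lDeltaTheta l)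
              (EtaleThetaDataOfSetting.aug C) I.Dmu hDq (EtaleThetaDataOfSetting.PiYdd C)
              (EtaleThetaDataOfSetting.continuous_aug C) (aug_ker_acts_trivially C) hlift hemb)
            cU (EtaleThetaDataOfSetting.isOpen_stabilizer_units C) (EtaleThetaDataOfSetting.finiteIndex_stabilizer_units C)
            (unitGroup ℚ_[p] (PadicAlgCl p)) ρlim).Hd) =
              Multiplicative.toAdd (h1LimKummer (EtaleThetaDataOfSetting.phi C) (D.lDeltaTheta l) I.Dmu cU
                (EtaleThetaDataOfSetting.isOpen_stabilizer_units C) (EtaleThetaDataOfSetting.finiteIndex_stabilizer_units C) u) →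
            e (Multiplicative.ofAdd (QuotientAddGroup.mk m)) =
              A.actIsm G (A.toIsm G w) (QuotientGroup.mk (Units.map ((A.tauto P).trans (A.mapOtri φ)).toMonoidHom (ιU u)))} := by
  obtain ⟨Δ, hΔ⟩ := cor112_iii_model C hC hS hl hp2 hpl hζ mods f hf hmods h15 L hZ hcharY hlim Env I hDq hlift hemb cU ρlim
    hcU A G _ (A.alphaTimesZHatOxmu_nonempty P G ιU)
  refine ⟨Δ, ?_⟩
  rw [hΔ]
  ext e
  simp only [Set.mem_setOf_eq]
  constructor
  · rintro ⟨π, ⟨φ, w, hπ⟩, he⟩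
    exact ⟨φ, w, fun u m hm => (he u m hm).trans (hπ u)⟩
  · rintro ⟨φ, w, he⟩
    obtain ⟨π, hπ⟩ := A.exists_oxmuEquiv_alphaTimes P G ιU φ
    refine ⟨π.trans (A.actIsm G (A.toIsm G w)), ⟨φ, w, fun v => ?_⟩, fun u m hm => ?_⟩
    · rw [MulEquiv.trans_apply, hπ]
    · rw [he u m hm, MulEquiv.trans_apply, hπ]

/-! ### … with the FULLY GENUINE [AbsTopIII]-output data (`Ism(G)` = print's isometry group) over `(k, ℚ̄_p)` -/

variable
  (k : Type) [Field k] [ValuativeRel k] [TopologicalSpace k] [IsNonarchimedeanLocalField k] [CharZero k]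
  [Algebra k (PadicAlgCl p)] [IsAlgClosure k (PadicAlgCl p)]
  (ε : (setting C hC hS hl hp2 hpl hζ mods f hf).Gk ≃ₜ*
    (ModelMLFGaloisData.galois ({ k := k, K := PadicAlgCl p } : MLFClosure.{0}).k
      ({ k := k, K := PadicAlgCl p } : MLFClosure.{0}).K).tmPair.Pi)
  (hΔ : ∀ φ : (setting C hC hS hl hp2 hpl hζ mods f hf).PiX ≃ₜ* (setting C hC hS hl hp2 hpl hζ mods f hf).PiX,
    (setting C hC hS hl hp2 hpl hζ mods f hf).DeltaX.map φ.toMulEquiv.toMonoidHom =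
      (setting C hC hS hl hp2 hpl hζ mods f hf).DeltaX)
  (hq : Nonempty (TopGroup.quot (setting C hC hS hl hp2 hpl hζ mods f hf).PiX (setting C hC hS hl hp2 hpl hζ mods f hf).DeltaX ≃ₜ*
    (setting C hC hS hl hp2 hpl hζ mods f hf).Gk))

/-- **[IUTchII] Cor 1.12 (iii) at the model with the FULLY GENUINE [AbsTopIII]-output data and `Γ^{×μ} = Ism(G)`**
(`AbsTopMonoids.genuineOfModelIsm` over `(k, ℚ̄_p)`, `k/ℚ_p` finite inside `ℚ̄_p`: `O^⊳(G) = 𝒪^⊳_{ℚ̄_p}`, `O^⊳(f) =` THE lift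
`liftM(φ_f)`, and `Ism(G) =` print's group of `G`-isometries of `(𝒪^⊳_{ℚ̄_p})ˣ⧸μ`, `genuineOfModelIsm_Ism`): the diagram
`(†μ,×μ)` EXISTS with `e ∈ poly₄₅` iff for some member `f : Π/Δ ⥲ G` of the full poly-isomorphism and some `G`-ISOMETRY
`γ ∈ Ism(G)`, `e` carries the class of `κ_D u` to `γ · [liftM(φ_f)(u)]` for every unit `u ∈ 𝒪^×_{ℚ̄_p}` (read in `𝒪^⊳_{ℚ̄_p}`).
Residual named inputs: `hcU`, `[G_{ℚ_p} : ε(D_{μ_-})] < ∞` + `hDq`/`hlift`/`hemb`, the producer's `ε`/(H1)/(H2).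
[claim: Mochizuki2012, status: disputed] (IUTchII §1 Cor 1.12 (iii), kurims p.58) -/
theorem cor112_iii_model_genuineIsm_of_tower [Algebra ℚ_[p] k] [FiniteDimensional ℚ_[p] k] [IsScalarTower ℚ_[p] k (PadicAlgCl p)]
    [(Subgroup.map (EtaleThetaDataOfSetting.aug C) I.Dmu).FiniteIndex] (hcU : Function.Bijective cU.hom)
    (G : IsoClass (setting C hC hS hl hp2 hpl hζ mods f hf).Gk) :
    ∃ Δ : MuXmuDiagram
        (thetaEvaluation C hC hS hl hp2 hpl hζ mods f hf hmods h15 L hZ hcharY hlim Env I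
            (LevelRetraction.ofAugmentation (EtaleThetaDataOfSetting.phi C) (D.lDeltaTheta l)
              (EtaleThetaDataOfSetting.aug C) I.Dmu hDq (EtaleThetaDataOfSetting.PiYdd C)
              (EtaleThetaDataOfSetting.continuous_aug C) (aug_ker_acts_trivially C) hlift hemb)
            cU (EtaleThetaDataOfSetting.isOpen_stabilizer_units C) (EtaleThetaDataOfSetting.finiteIndex_stabilizer_units C)
            (unitGroup ℚ_[p] (PadicAlgCl p)) ρlim)
        (AbsTopMonoids.genuineOfModelIsm (setting C hC hS hl hp2 hpl hζ mods f hf) { k := k, K := PadicAlgCl p } ε hΔ hq) G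
        ↥(AddCommGroup.torsion (thetaEnvData C hC hS hl hp2 hpl hζ mods f hf hmods h15 L hZ hcharY hlim).cohEnv.lim)
        (AddCommGroup.torsion (thetaEnvData C hC hS hl hp2 hpl hζ mods f hf hmods h15 L hZ hcharY hlim).cohEnv.lim).subtype,
      Δ.poly₄₅ = {e | ∃ (φ : AbsTopMonoids.Genuine.qObj hq (IsoClass.base (setting C hC hS hl hp2 hpl hζ mods f hf).PiX) ⟶ G)
          (γ : (AbsTopMonoids.genuineOfModelIsm (setting C hC hS hl hp2 hpl hζ mods f hf) { k := k, K := PadicAlgCl p } ε hΔ hq).Ism G),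
        ∀ (u : ↥(unitGroup ℚ_[p] (PadicAlgCl p)))
          (m : ↥(thetaEvaluation C hC hS hl hp2 hpl hζ mods f hf hmods h15 L hZ hcharY hlim Env I
            (LevelRetraction.ofAugmentation (EtaleThetaDataOfSetting.phi C) (D.lDeltaTheta l)
              (EtaleThetaDataOfSetting.aug C) I.Dmu hDq (EtaleThetaDataOfSetting.PiYdd C)
              (EtaleThetaDataOfSetting.continuous_aug C) (aug_ker_acts_trivially C) hlift hemb)
            cU (EtaleThetaDataOfSetting.isOpen_stabilizer_units C) (EtaleThetaDataOfSetting.finiteIndex_stabilizer_units C)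
            (unitGroup ℚ_[p] (PadicAlgCl p)) ρlim).MxTM)
          (w : (nonzeroIntegers k (PadicAlgCl p))ˣ),
          (m : (thetaEvaluation C hC hS hl hp2 hpl hζ mods f hf hmods h15 L hZ hcharY hlim Env I
            (LevelRetraction.ofAugmentation (EtaleThetaDataOfSetting.phi C) (D.lDeltaTheta l)
              (EtaleThetaDataOfSetting.aug C) I.Dmu hDq (EtaleThetaDataOfSetting.PiYdd C)
              (EtaleThetaDataOfSetting.continuous_aug C) (aug_ker_acts_trivially C) hlift hemb)
            cU (EtaleThetaDataOfSetting.isOpen_stabilizer_units C) (EtaleThetaDataOfSetting.finiteIndex_stabilizer_units C)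
            (unitGroup ℚ_[p] (PadicAlgCl p)) ρlim).Hd) =
              Multiplicative.toAdd (h1LimKummer (EtaleThetaDataOfSetting.phi C) (D.lDeltaTheta l) I.Dmu cU
                (EtaleThetaDataOfSetting.isOpen_stabilizer_units C) (EtaleThetaDataOfSetting.finiteIndex_stabilizer_units C) u) →
          ((w : nonzeroIntegers k (PadicAlgCl p)) : PadicAlgCl p) = ((u : (PadicAlgCl p)ˣ) : PadicAlgCl p) →
            e (Multiplicative.ofAdd (QuotientAddGroup.mk m)) =
              (AbsTopMonoids.genuineOfModelIsm (setting C hC hS hl hp2 hpl hζ mods f hf) { k := k, K := PadicAlgCl p } ε hΔ hq).actIsm G γ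
                (QuotientGroup.mk (Units.map (AbsTopMonoids.Genuine.liftM ({ k := k, K := PadicAlgCl p } : MLFClosure.{0})
                  (AbsTopMonoids.Genuine.phiOf ({ k := k, K := PadicAlgCl p } : MLFClosure.{0}) ε φ)).toMonoidHom w))} := by
  -- the canonical identification of the unit constants with `(𝒪^⊳_{ℚ̄_p})^×` (identity on elements of `ℚ̄_p`)
  have hOk : unitGroup k (PadicAlgCl p) = unitGroup ℚ_[p] (PadicAlgCl p) := by
    ext u
    rw [mem_unitGroup_iff, mem_unitGroup_iff, unitSubmonoid_eq_of_isNonarchimedeanLocalField p]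
  obtain ⟨ι, hι⟩ := AbsTopMonoids.genuineOfModel_exists_unitsEquiv (setting C hC hS hl hp2 hpl hζ mods f hf)
    { k := k, K := PadicAlgCl p } ε hΔ hq (IsoClass.base _)
  let ιU : ↥(unitGroup ℚ_[p] (PadicAlgCl p)) ≃*
      ((AbsTopMonoids.genuineOfModelIsm (setting C hC hS hl hp2 hpl hζ mods f hf) { k := k, K := PadicAlgCl p } ε hΔ hq).MTM
        (IsoClass.base _))ˣ :=
    (MulEquiv.subgroupCongr hOk.symm).trans ι
  have hιU : ∀ u : ↥(unitGroup ℚ_[p] (PadicAlgCl p)),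
      (Subtype.val (Units.val (ιU u)) : PadicAlgCl p) = ((u : (PadicAlgCl p)ˣ) : PadicAlgCl p) := fun u => hι _
  -- a unit of `𝒪^⊳_{ℚ̄_p}` is determined by its underlying element of `ℚ̄_p`
  have hw : ∀ (u : ↥(unitGroup ℚ_[p] (PadicAlgCl p))) (w : (nonzeroIntegers k (PadicAlgCl p))ˣ),
      ((w : nonzeroIntegers k (PadicAlgCl p)) : PadicAlgCl p) = ((u : (PadicAlgCl p)ˣ) : PadicAlgCl p) → w = ιU u := by
    intro u w h
    exact Units.ext (Subtype.ext (h.trans (hιU u).symm))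
  obtain ⟨Δ, hΔ'⟩ := cor112_iii_model_ismOrbit_of_unitsEquiv C hC hS hl hp2 hpl hζ mods f hf hmods h15 L hZ hcharY hlim Env I hDq
    hlift hemb cU ρlim hcU
    (AbsTopMonoids.genuineOfModelIsm (setting C hC hS hl hp2 hpl hζ mods f hf) { k := k, K := PadicAlgCl p } ε hΔ hq)
    (IsoClass.base _) G ιU
  refine ⟨Δ, ?_⟩
  rw [hΔ']
  ext e
  simp only [Set.mem_setOf_eq]
  constructor
  · rintro ⟨φ, γ, he⟩
    refine ⟨φ, γ, fun u m w hm hwu => ?_⟩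
    rw [he u m hm, hw u w hwu]
    rfl
  · rintro ⟨φ, γ, he⟩
    refine ⟨φ, γ, fun u m hm => ?_⟩
    rw [he u m (ιU u) hm (hιU u)]
    rfl

/-- **… and with `Γ^{×μ} = Im(Ẑ^×)`** (the image of `Ẑ^× ↠ ℤ_p^× ↪ Ism(G)`, GENUINE: `w ∈ Ẑ^×` acts as
`x ↦ x^{χ_p(w)}`, `AbsTopMonoids.toAdd_log_actIsm_toIsm`): `e ∈ poly₄₅` iff for some `f` and some `w ∈ Ẑ^×`,
`e[κ_D u] = w · [liftM(φ_f)(u)] = [liftM(φ_f)(u)]^{χ_p(w)}` for every unit `u`.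
[claim: Mochizuki2012, status: disputed] (IUTchII §1 Cor 1.12 (iii), kurims p.58) -/
theorem cor112_iii_model_genuineZHat_of_tower [Algebra ℚ_[p] k] [FiniteDimensional ℚ_[p] k] [IsScalarTower ℚ_[p] k (PadicAlgCl p)]
    [(Subgroup.map (EtaleThetaDataOfSetting.aug C) I.Dmu).FiniteIndex] (hcU : Function.Bijective cU.hom)
    (G : IsoClass (setting C hC hS hl hp2 hpl hζ mods f hf).Gk) :
    ∃ Δ : MuXmuDiagram
        (thetaEvaluation C hC hS hl hp2 hpl hζ mods f hf hmods h15 L hZ hcharY hlim Env I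
            (LevelRetraction.ofAugmentation (EtaleThetaDataOfSetting.phi C) (D.lDeltaTheta l)
              (EtaleThetaDataOfSetting.aug C) I.Dmu hDq (EtaleThetaDataOfSetting.PiYdd C)
              (EtaleThetaDataOfSetting.continuous_aug C) (aug_ker_acts_trivially C) hlift hemb)
            cU (EtaleThetaDataOfSetting.isOpen_stabilizer_units C) (EtaleThetaDataOfSetting.finiteIndex_stabilizer_units C)
            (unitGroup ℚ_[p] (PadicAlgCl p)) ρlim)
        (AbsTopMonoids.genuineOfModelIsm (setting C hC hS hl hp2 hpl hζ mods f hf) { k := k, K := PadicAlgCl p } ε hΔ hq) G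
        ↥(AddCommGroup.torsion (thetaEnvData C hC hS hl hp2 hpl hζ mods f hf hmods h15 L hZ hcharY hlim).cohEnv.lim)
        (AddCommGroup.torsion (thetaEnvData C hC hS hl hp2 hpl hζ mods f hf hmods h15 L hZ hcharY hlim).cohEnv.lim).subtype,
      Δ.poly₄₅ = {e | ∃ (φ : AbsTopMonoids.Genuine.qObj hq (IsoClass.base (setting C hC hS hl hp2 hpl hζ mods f hf).PiX) ⟶ G)
          (w' : ZHatUnits),
        ∀ (u : ↥(unitGroup ℚ_[p] (PadicAlgCl p)))
          (m : ↥(thetaEvaluation C hC hS hl hp2 hpl hζ mods f hf hmods h15 L hZ hcharY hlim Env I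
            (LevelRetraction.ofAugmentation (EtaleThetaDataOfSetting.phi C) (D.lDeltaTheta l)
              (EtaleThetaDataOfSetting.aug C) I.Dmu hDq (EtaleThetaDataOfSetting.PiYdd C)
              (EtaleThetaDataOfSetting.continuous_aug C) (aug_ker_acts_trivially C) hlift hemb)
            cU (EtaleThetaDataOfSetting.isOpen_stabilizer_units C) (EtaleThetaDataOfSetting.finiteIndex_stabilizer_units C)
            (unitGroup ℚ_[p] (PadicAlgCl p)) ρlim).MxTM)
          (w : (nonzeroIntegers k (PadicAlgCl p))ˣ),
          (m : (thetaEvaluation C hC hS hl hp2 hpl hζ mods f hf hmods h15 L hZ hcharY hlim Env I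
            (LevelRetraction.ofAugmentation (EtaleThetaDataOfSetting.phi C) (D.lDeltaTheta l)
              (EtaleThetaDataOfSetting.aug C) I.Dmu hDq (EtaleThetaDataOfSetting.PiYdd C)
              (EtaleThetaDataOfSetting.continuous_aug C) (aug_ker_acts_trivially C) hlift hemb)
            cU (EtaleThetaDataOfSetting.isOpen_stabilizer_units C) (EtaleThetaDataOfSetting.finiteIndex_stabilizer_units C)
            (unitGroup ℚ_[p] (PadicAlgCl p)) ρlim).Hd) =
              Multiplicative.toAdd (h1LimKummer (EtaleThetaDataOfSetting.phi C) (D.lDeltaTheta l) I.Dmu cU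
                (EtaleThetaDataOfSetting.isOpen_stabilizer_units C) (EtaleThetaDataOfSetting.finiteIndex_stabilizer_units C) u) →
          ((w : nonzeroIntegers k (PadicAlgCl p)) : PadicAlgCl p) = ((u : (PadicAlgCl p)ˣ) : PadicAlgCl p) →
            e (Multiplicative.ofAdd (QuotientAddGroup.mk m)) =
              (AbsTopMonoids.genuineOfModelIsm (setting C hC hS hl hp2 hpl hζ mods f hf) { k := k, K := PadicAlgCl p } ε hΔ hq).actIsm G
                ((AbsTopMonoids.genuineOfModelIsm (setting C hC hS hl hp2 hpl hζ mods f hf) { k := k, K := PadicAlgCl p } ε hΔ hq).toIsm G w')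
                (QuotientGroup.mk (Units.map (AbsTopMonoids.Genuine.liftM ({ k := k, K := PadicAlgCl p } : MLFClosure.{0})
                  (AbsTopMonoids.Genuine.phiOf ({ k := k, K := PadicAlgCl p } : MLFClosure.{0}) ε φ)).toMonoidHom w))} := by
  -- the canonical identification of the unit constants with `(𝒪^⊳_{ℚ̄_p})^×` (identity on elements of `ℚ̄_p`)
  have hOk : unitGroup k (PadicAlgCl p) = unitGroup ℚ_[p] (PadicAlgCl p) := by
    ext u
    rw [mem_unitGroup_iff, mem_unitGroup_iff, unitSubmonoid_eq_of_isNonarchimedeanLocalField p]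
  obtain ⟨ι, hι⟩ := AbsTopMonoids.genuineOfModel_exists_unitsEquiv (setting C hC hS hl hp2 hpl hζ mods f hf)
    { k := k, K := PadicAlgCl p } ε hΔ hq (IsoClass.base _)
  let ιU : ↥(unitGroup ℚ_[p] (PadicAlgCl p)) ≃*
      ((AbsTopMonoids.genuineOfModelIsm (setting C hC hS hl hp2 hpl hζ mods f hf) { k := k, K := PadicAlgCl p } ε hΔ hq).MTM
        (IsoClass.base _))ˣ :=
    (MulEquiv.subgroupCongr hOk.symm).trans ι
  have hιU : ∀ u : ↥(unitGroup ℚ_[p] (PadicAlgCl p)),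
      (Subtype.val (Units.val (ιU u)) : PadicAlgCl p) = ((u : (PadicAlgCl p)ˣ) : PadicAlgCl p) := fun u => hι _
  -- a unit of `𝒪^⊳_{ℚ̄_p}` is determined by its underlying element of `ℚ̄_p`
  have hw : ∀ (u : ↥(unitGroup ℚ_[p] (PadicAlgCl p))) (w : (nonzeroIntegers k (PadicAlgCl p))ˣ),
      ((w : nonzeroIntegers k (PadicAlgCl p)) : PadicAlgCl p) = ((u : (PadicAlgCl p)ˣ) : PadicAlgCl p) → w = ιU u := by
    intro u w h
    exact Units.ext (Subtype.ext (h.trans (hιU u).symm))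
  obtain ⟨Δ, hΔ'⟩ := cor112_iii_model_zhatOrbit_of_unitsEquiv C hC hS hl hp2 hpl hζ mods f hf hmods h15 L hZ hcharY hlim Env I hDq
    hlift hemb cU ρlim hcU
    (AbsTopMonoids.genuineOfModelIsm (setting C hC hS hl hp2 hpl hζ mods f hf) { k := k, K := PadicAlgCl p } ε hΔ hq)
    (IsoClass.base _) G ιU
  refine ⟨Δ, ?_⟩
  rw [hΔ']
  ext e
  simp only [Set.mem_setOf_eq]
  constructor
  · rintro ⟨φ, w', he⟩
    refine ⟨φ, w', fun u m w hm hwu => ?_⟩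
    rw [he u m hm, hw u w hwu]
    rfl
  · rintro ⟨φ, w', he⟩
    refine ⟨φ, w', fun u m hm => ?_⟩
    rw [he u m (ιU u) hm (hιU u)]
    rfl

end EtaleLevels

end Literature.IUT.HodgeArakelov

end
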